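import Summits.FinalStateConjecture.FinalStateConjecture.Statement
import Summits.FinalStateConjecture.FinalStateConjecture.Theorems.GapDecaySuffices.Negative.RelabelDecomposition
import Summits.FinalStateConjecture.FinalStateConjecture.Theorems.EIHFluxBalanceInertialRecessionFlatPackage
import Literature.Geometry.Lorentzian.KerrConvergenceProofs
import HarnessLib

/-!
# Crux `DispersingCapture` (stmt-FinalStateConjecture-17643), line `registered` (birth r4) —
# stub `stub_boostTransport` (B₂a, boost transport of the rest-frame settled data)

Rest-frame settled data of a vacuum Cauchy development — Kerr–Schild hole charts `Ψᵢ` on the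
Kerr exteriors `Kerr.exterior (Mᵢ, aᵢ)` (late charts into `O` after `T₁`, `C²` convergence out to
growing radii `Rᵢ(τ)`, separation at every radius, region identity, exhaustion in the
`certifiedLate`/`certifiedSlab` shape, eventual future-orientation (F) of `dΨᵢ(V_{Mᵢ,aᵢ})` on
truncated slabs), a flat chart `Φ₀` on `U₁ ⊇ {t > T₁} ∖ ⋃ᵢ {distᵢ ≤ ρ(t)}` with `ρ(t)/t → 0`, and
Cesàro velocities `t⁻¹ ξᵢ(t) → vᵢ`, `‖vᵢ‖ ≤ V < 1` — are transported to the BOOSTED exteriors of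
the pure boosts `Λᵢ = boost vᵢ`:

* the motion of label `i` is `((Λᵢ⁻¹)⁻¹ · 1, Λᵢ (0 − 0)) = (Λᵢ, 0)` (the relabelling of the rest
  frame by the model map `P = Λᵢ⁻¹`, toolkit `…GapDecaySuffices.Negative.Relabel`), the chart is
  `ψᵢ = Ψᵢ ∘ P`; rest-frame time and radius transform by precomposition with `P`, so late images,
  growing zones, truncated tubes and slabs of `ψᵢ` ARE those of `Ψᵢ` (`image_comp_pre_setOf`) and
  the late-chart / separation / region / exhaustion clauses are rewrites of the hypotheses;
  `truncDeviationCk` is multiplied by at most `jetConst Λᵢ⁻¹ 2 < ∞` (`truncDeviationCk_comp_pre_le`,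
  valid at every radius, hence along `Rᵢ(τ)`);
* excision radii `ρexcᵢ(t) = (1 + 3|γᵢ|)(ρ(t) + ‖ξᵢ(t) − t vᵢ‖) + 1` (`excR⟪…⟫`): sublinear by
  `tendsto_drift_div_of_cesaro` / `tendsto_excisionRadius_div`, and the straight tubes contain the
  drifting ones by `radius_poincareInv_le_of_near_centre'`;
* orthochronous motions (`boost_apply_basisVector_zero_zero_pos`) and oriented hole slabs by the
  chain rule `d(Ψᵢ ∘ Λᵢ⁻¹)(Λᵢ V) = dΨᵢ(V)` (`mfderiv_comp_pre_apply`).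

The toolkit starts from `boostedKerrBackground 1 0 M a`, equal to `Kerr.background M a` only
propositionally (`boostedKerrBackground_one_zero`); the theorem is first proved for a family of
backgrounds `B = fun i ↦ boostedKerrBackground 1 0 (Mᵢ) (aᵢ)` (`boostTransport_of_eq`, `subst`) and
then instantiated at `B = fun i ↦ Kerr.background (Mᵢ) (aᵢ)` by `funext`.

References: O'Neill 1983, Ch. 9 (Lorentz/Poincaré maps); Kerr–Schild 1965 (Lorentz covariance of
the Kerr–Schild form); Dafermos–Luk arXiv:1710.01722, Conjecture 1; DHRT arXiv:2104.08222, §1.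
-/

set_option linter.dupNamespace false

noncomputable section

open scoped Manifold ContDiff Topology ENNReal
open Filter Set Function TopologicalSpace Literature.Geometry.Lorentzian
open Summit.FinalStateConjecture.FinalStateConjecture.Theorems.GapDecaySuffices.Negative.Relabel

namespace Summit.FinalStateConjecture.FinalStateConjecture.Theorems.DissipativeFinalMotions.DispersingCapture

/-! ### Straight sublinear excision tubes about a constant motion -/

/-- The Lorentz factor `γ = (Λe₀)⁰` of the constant motion `Λ` (file-local notation). -/
local notation "γ⟪" Λ "⟫" => (((Λ : lorentzGroup) : E4 ≃L[ℝ] E4) (E4.basisVector 0)) 0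

/-- The lab velocity `u = (Λe₀)~/(Λe₀)⁰` of the constant motion `Λ` (file-local notation). -/
local notation "u⟪" Λ "⟫" =>
  ((((Λ : lorentzGroup) : E4 ≃L[ℝ] E4) (E4.basisVector 0)) 0)⁻¹ •
    E4.spatial (((Λ : lorentzGroup) : E4 ≃L[ℝ] E4) (E4.basisVector 0))

/-- The **excision radius** about the straight world-line of the constant motion `(Λ, c)` fed by a
drifting tube profile `ρ` about the actual centre `ξ`, at lab time `t`:
`(1 + 3|γ|)·(ρ(t) + ‖ξ(t) − (c̲ + (t − c⁰)u)‖) + 1` (file-local notation). -/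
local notation "excR⟪" Λ ", " c ", " ρ ", " ξ ", " t "⟫" =>
  (1 + 3 * |γ⟪Λ⟫|) * (ρ t + ‖ξ t - (E4.spatial c + (t - c 0) • u⟪Λ⟫)‖) + 1

/-- **The straight tube contains the drifting tube**: a lab point painted farther than the
excision radius from the line of the motion `(Λ, c)` is farther than `ρ(x⁰)` from the actual
centre `ξ(x⁰)` (contrapositive of `radius_poincareInv_le_of_near_centre'`). [folklore] -/
theorem lt_dist_of_excRadius_lt (Λ : lorentzGroup) (c : E4) (a : ℝ) (ρ : ℝ → ℝ) (ξ : ℝ → E3)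
    {x : E4} (hx : excR⟪Λ, c, ρ, ξ, (x 0)⟫ < Kerr.radius a (poincareInv Λ c x)) :
    ρ (x 0) < ‖E4.spatial x - ξ (x 0)‖ := by
  by_contra hle
  have h := radius_poincareInv_le_of_near_centre' Λ c a ξ ρ (not_lt.mp hle)
  linarith

/-- **The excision radius is sublinear** when `ρ(t)/t → 0` and the centre has the Cesàro
velocity of the motion, `t⁻¹ ξ(t) → u = (Λe₀)~/(Λe₀)⁰` (`tendsto_drift_div_of_cesaro`,
`tendsto_excisionRadius_div`). [folklore] -/
theorem tendsto_excRadius_div (Λ : lorentzGroup) (c : E4) {ρ : ℝ → ℝ} {ξ : ℝ → E3}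
    (hρ : Tendsto (fun t ↦ ρ t / t) atTop (𝓝 0))
    (hξ : Tendsto (fun t : ℝ ↦ t⁻¹ • ξ t) atTop (𝓝 u⟪Λ⟫)) :
    Tendsto (fun t ↦ excR⟪Λ, c, ρ, ξ, t⟫ / t) atTop (𝓝 0) := by
  have h1 := tendsto_excisionRadius_div (1 + 3 * |γ⟪Λ⟫|) hρ
    (tendsto_drift_div_of_cesaro hξ (c 0) (E4.spatial c))
  have h2 : Tendsto (fun t : ℝ ↦ (1 : ℝ) / t) atTop (𝓝 0) :=
    tendsto_const_nhds.div_atTop tendsto_id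
  have h3 := h1.add h2
  rw [add_zero] at h3
  refine h3.congr fun t ↦ ?_
  rw [add_div]

/-! ### The transport, for the family `B = fun i ↦ boostedKerrBackground 1 0 (Mᵢ) (aᵢ)` -/

section Transport

variable {X : Type} [TopologicalSpace X] [ChartedSpace E3 X] [IsManifold (𝓡 3) ∞ X]
  [ConnectedSpace X] {D : InitialDataSet (𝓡 3) X}

/-- **Boost transport of rest-frame settled data** over a family of backgrounds `B` EQUAL to the
boosted Kerr backgrounds of the trivial motion (`subst`-able form of `stub_boostTransport`; see the
module docstring for the construction: motions `((boost vᵢ)⁻¹⁻¹·1, (boost vᵢ)(0 − 0))`, charts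
`Ψᵢ ∘ pre 1 (boost vᵢ)⁻¹ 0 0`, excision radii `excR⟪…⟫`). [folklore] -/
theorem boostTransport_of_eq (𝒟 : VacuumCauchyDevelopment D) (N : ℕ) (M a : Fin N → ℝ)
    (T₁ V : ℝ) (ξ : Fin N → ℝ → E3) (v : Fin N → E3) (O : Set 𝒟.carrier) (U₁ : Opens E4)
    (Φ₀ : (Minkowski.backgroundOn U₁).domain → 𝒟.carrier) (B : Fin N → ModelBackground)
    (hB : B = fun i ↦ boostedKerrBackground 1 0 (M i) (a i)) (Ψ : (i : Fin N) → (B i).domain → 𝒟.carrier)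
    (ρ : ℝ → ℝ) (R : Fin N → ℝ → ℝ) (hV : V < 1) (hv : ∀ i, ‖v i‖ ≤ V)
    (hces : ∀ i, Tendsto (fun t : ℝ ↦ t⁻¹ • ξ i t) atTop (𝓝 (v i)))
    (hΨ : ∀ i, 𝒟.toSpacetime.IsLateChart (B i) O T₁ (Ψ i))
    (hρ : Tendsto (fun t ↦ ρ t / t) atTop (𝓝 0))
    (hU₁ : {y : E4 | T₁ < y 0 ∧ ∀ i, ρ (y 0) < ‖E4.spatial y - ξ i (y 0)‖} ⊆ (U₁ : Set E4))
    (hconv : ∀ i, Tendsto (fun τ ↦ 𝒟.toSpacetime.truncDeviationCk (B i) (Ψ i) 2 (R i τ) τ)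
      atTop (𝓝 0))
    (hsep : ∀ R' : ℝ, ∃ τ' : ℝ,
      Pairwise (Function.onFun Disjoint fun i ↦ Ψ i '' (B i).truncLateRegion τ' R'))
    (hO : O = exteriorOf 𝒟.toCauchyDevelopment (Φ₀ '' (Minkowski.backgroundOn U₁).lateRegion T₁ ∪
      ⋃ i, Ψ i '' (B i).lateRegion T₁))
    (hexh : ∀ τ₁, T₁ < τ₁ → O \ (Φ₀ '' (Minkowski.backgroundOn U₁).lateRegion τ₁ ∪
      ⋃ i, Ψ i '' {x : (B i).domain | τ₁ < (B i).time x.1 ∧ (B i).radius x.1 ≤ R i ((B i).time x.1)}) ⊆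
        𝒟.toSpacetime.metric.causalPast 𝒟.toSpacetime.timeOrientation
          (Φ₀ '' (Minkowski.backgroundOn U₁).timeSlab τ₁ ∪ ⋃ i, Ψ i '' (B i).truncTimeSlab (R i τ₁) τ₁))
    (hF : ∀ i (ρ' : ℝ), ∀ᶠ τ in atTop, ∀ x ∈ (B i).truncTimeSlab ρ' τ,
      𝒟.toSpacetime.timeOrientation.IsFutureDirected
        (mfderiv 𝓘(ℝ, E4) (𝓡 4) (Ψ i) x (Kerr.timeVector (M i) (a i) x.1))) :
    ∃ (mo : Fin N → lorentzGroup × E4)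
      (ψ : (i : Fin N) → (boostedKerrBackground (mo i).1 (mo i).2 (M i) (a i)).domain → 𝒟.carrier)
      (ρexc : Fin N → ℝ → ℝ),
      (∀ i, 𝒟.toSpacetime.IsLateChart (boostedKerrBackground (mo i).1 (mo i).2 (M i) (a i)) O T₁ (ψ i)) ∧
      (∀ i, Tendsto (fun τ ↦ 𝒟.toSpacetime.truncDeviationCk
        (boostedKerrBackground (mo i).1 (mo i).2 (M i) (a i)) (ψ i) 2 (R i τ) τ) atTop (𝓝 0)) ∧
      (∀ R' : ℝ, ∃ τ' : ℝ, Pairwise (Function.onFun Disjoint fun i ↦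
        ψ i '' (boostedKerrBackground (mo i).1 (mo i).2 (M i) (a i)).truncLateRegion τ' R')) ∧
      (∀ i, Tendsto (fun t ↦ ρexc i t / t) atTop (𝓝 0)) ∧
      {x : E4 | T₁ < x 0 ∧ ∀ i, ρexc i (x 0) <
        Kerr.radius (a i) (poincareInv (mo i).1 (mo i).2 x)} ⊆ (U₁ : Set E4) ∧
      (∀ i, IsOrthochronous (mo i).1) ∧
      (∀ i (ρ' : ℝ), ∀ᶠ τ in atTop,
        ∀ x ∈ (boostedKerrBackground (mo i).1 (mo i).2 (M i) (a i)).truncTimeSlab ρ' τ,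
          𝒟.toSpacetime.timeOrientation.IsFutureDirected (mfderiv 𝓘(ℝ, E4) (𝓡 4) (ψ i) x
            (((mo i).1 : E4 ≃L[ℝ] E4)
              (Kerr.timeVector (M i) (a i) (poincareInv (mo i).1 (mo i).2 (x : E4)))))) ∧
      O = exteriorOf 𝒟.toCauchyDevelopment (Φ₀ '' (Minkowski.backgroundOn U₁).lateRegion T₁ ∪
        ⋃ i, ψ i '' (boostedKerrBackground (mo i).1 (mo i).2 (M i) (a i)).lateRegion T₁) ∧
      (∀ τ₁, T₁ < τ₁ → O \ (Φ₀ '' (Minkowski.backgroundOn U₁).lateRegion τ₁ ∪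
        ⋃ i, ψ i '' {x : (boostedKerrBackground (mo i).1 (mo i).2 (M i) (a i)).domain |
          τ₁ < (boostedKerrBackground (mo i).1 (mo i).2 (M i) (a i)).time x.1 ∧
            (boostedKerrBackground (mo i).1 (mo i).2 (M i) (a i)).radius x.1 ≤
              R i ((boostedKerrBackground (mo i).1 (mo i).2 (M i) (a i)).time x.1)}) ⊆
        𝒟.toSpacetime.metric.causalPast 𝒟.toSpacetime.timeOrientation
          (Φ₀ '' (Minkowski.backgroundOn U₁).timeSlab τ₁ ∪
            ⋃ i, ψ i '' (boostedKerrBackground (mo i).1 (mo i).2 (M i) (a i)).truncTimeSlab (R i τ₁) τ₁)) := by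
  subst hB
  -- the pure boosts of the Cesàro velocities, and the model maps `P = Λᵢ⁻¹` of the relabelling
  have hv1 : ∀ i, ‖v i‖ < 1 := fun i ↦ (hv i).trans_lt hV
  obtain ⟨L, hL⟩ : ∃ L : Fin N → lorentzGroup, ∀ i, L i = (Lorentz.boost (v i) (hv1 i))⁻¹ :=
    ⟨fun i ↦ (Lorentz.boost (v i) (hv1 i))⁻¹, fun i ↦ rfl⟩
  have hLb : ∀ i, (L i)⁻¹ * 1 = Lorentz.boost (v i) (hv1 i) := fun i ↦ by
    rw [mul_one, hL i, inv_inv]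
  /- (1) late charts -/
  have h1 : ∀ i, 𝒟.toSpacetime.IsLateChart (Bnew 1 (L i) 0 0 (M i) (a i)) O T₁
      (Ψ i ∘ pre 1 (L i) 0 0 (M i) (a i)) := fun i ↦
    isLateChart_comp_pre 1 (L i) 0 0 (M i) (a i) (hΨ i)
  /- (2) truncated `C²` convergence along the growing radii -/
  have h2 : ∀ i, Tendsto (fun τ ↦ 𝒟.toSpacetime.truncDeviationCk (Bnew 1 (L i) 0 0 (M i) (a i))
      (Ψ i ∘ pre 1 (L i) 0 0 (M i) (a i)) 2 (R i τ) τ) atTop (𝓝 0) := fun i ↦ by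
    have hlim : Tendsto (fun τ ↦ jetConst (L i) 2 *
        𝒟.toSpacetime.truncDeviationCk (boostedKerrBackground 1 0 (M i) (a i)) (Ψ i) 2 (R i τ) τ)
        atTop (𝓝 0) := by
      have h := ENNReal.Tendsto.const_mul (hconv i) (Or.inr (jetConst_ne_top (L i) 2))
      rw [mul_zero] at h
      exact h
    exact tendsto_of_tendsto_of_tendsto_of_le_of_le tendsto_const_nhds hlim (fun _ ↦ bot_le)
      fun τ ↦ truncDeviationCk_comp_pre_le (Ψ i) (hΨ i).contMDiff 2 (R i τ) τ
  /- (3) separation at every radius -/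
  have h3 : ∀ R' : ℝ, ∃ τ' : ℝ, Pairwise (Function.onFun Disjoint fun i ↦
      (Ψ i ∘ pre 1 (L i) 0 0 (M i) (a i)) '' (Bnew 1 (L i) 0 0 (M i) (a i)).truncLateRegion τ' R') := by
    intro R'
    obtain ⟨τ', hτ'⟩ := hsep R'
    refine ⟨τ', fun i j hij ↦ ?_⟩
    have e : ∀ i, (Ψ i ∘ pre 1 (L i) 0 0 (M i) (a i)) ''
        (Bnew 1 (L i) 0 0 (M i) (a i)).truncLateRegion τ' R' =
          Ψ i '' (boostedKerrBackground 1 0 (M i) (a i)).truncLateRegion τ' R' := fun i ↦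
      image_comp_pre_setOf 1 (L i) 0 0 (M i) (a i) (Ψ i) fun t r ↦ τ' < t ∧ r ≤ R'
    show Disjoint ((Ψ i ∘ pre 1 (L i) 0 0 (M i) (a i)) ''
        (Bnew 1 (L i) 0 0 (M i) (a i)).truncLateRegion τ' R')
      ((Ψ j ∘ pre 1 (L j) 0 0 (M j) (a j)) '' (Bnew 1 (L j) 0 0 (M j) (a j)).truncLateRegion τ' R')
    rw [e i, e j]
    exact hτ' hij
  /- (4) sublinear excision radii -/
  have h4 : ∀ i, Tendsto (fun t ↦ excR⟪(L i)⁻¹ * 1, (L i : E4 ≃L[ℝ] E4).symm (0 - 0), ρ, ξ i, t⟫ / t)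
      atTop (𝓝 0) := fun i ↦
    tendsto_excRadius_div _ _ hρ (by rw [hLb i, boostVelocity_boost (hv1 i)]; exact hces i)
  /- (5) the straight tubes lie inside the drifting ones -/
  have h5 : {x : E4 | T₁ < x 0 ∧ ∀ i,
      excR⟪(L i)⁻¹ * 1, (L i : E4 ≃L[ℝ] E4).symm (0 - 0), ρ, ξ i, (x 0)⟫ <
        Kerr.radius (a i) (poincareInv ((L i)⁻¹ * 1) ((L i : E4 ≃L[ℝ] E4).symm (0 - 0)) x)} ⊆
      (U₁ : Set E4) := fun x hx ↦
    hU₁ ⟨hx.1, fun i ↦ lt_dist_of_excRadius_lt _ _ (a i) ρ (ξ i) (hx.2 i)⟩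
  /- (6) orthochronous motions -/
  have h6 : ∀ i, IsOrthochronous ((L i)⁻¹ * 1) := fun i ↦ by
    rw [hLb i]
    exact boost_apply_basisVector_zero_zero_pos (hv1 i)
  /- (7) oriented hole slabs, by the chain rule -/
  have h7 : ∀ i (ρ' : ℝ), ∀ᶠ τ in atTop,
      ∀ x ∈ (Bnew 1 (L i) 0 0 (M i) (a i)).truncTimeSlab ρ' τ,
        𝒟.toSpacetime.timeOrientation.IsFutureDirected
          (mfderiv 𝓘(ℝ, E4) (𝓡 4) (Ψ i ∘ pre 1 (L i) 0 0 (M i) (a i)) x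
            ((((L i)⁻¹ * 1 : lorentzGroup) : E4 ≃L[ℝ] E4) (Kerr.timeVector (M i) (a i)
              (poincareInv ((L i)⁻¹ * 1) ((L i : E4 ≃L[ℝ] E4).symm (0 - 0)) (x : E4))))) := by
    intro i ρ'
    filter_upwards [hF i ρ'] with τ hτ x hx
    -- the corresponding rest-frame slab point
    have hx' : pre 1 (L i) 0 0 (M i) (a i) x ∈
        (boostedKerrBackground 1 0 (M i) (a i)).truncTimeSlab ρ' τ := by
      rw [ModelBackground.mem_truncTimeSlab] at hx ⊢
      rw [pre_coe, ← time_relabel 1 (L i) 0 0 (M i) (a i), ← radius_relabel 1 (L i) 0 0 (M i) (a i)]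
      exact hx
    have hcoe : ∀ u : E4, (((L i)⁻¹ * 1 : lorentzGroup) : E4 ≃L[ℝ] E4) u =
        (L i : E4 ≃L[ℝ] E4).symm u := fun u ↦ rfl
    rw [mfderiv_comp_pre_apply (Ψ i) (hΨ i).contMDiff, hcoe, ContinuousLinearEquiv.apply_symm_apply,
      poincareInv_relabel 1 (L i) 0 0, poincareInv_one_zero]
    exact hτ _ hx'
  /- (8) region identity and (9) exhaustion: the late images, zones and slabs are the same sets -/
  have e8 : ∀ i, (Ψ i ∘ pre 1 (L i) 0 0 (M i) (a i)) '' (Bnew 1 (L i) 0 0 (M i) (a i)).lateRegion T₁ =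
      Ψ i '' (boostedKerrBackground 1 0 (M i) (a i)).lateRegion T₁ := fun i ↦
    image_comp_pre_setOf 1 (L i) 0 0 (M i) (a i) (Ψ i) fun t _ ↦ T₁ < t
  have h8 : O = exteriorOf 𝒟.toCauchyDevelopment (Φ₀ '' (Minkowski.backgroundOn U₁).lateRegion T₁ ∪
      ⋃ i, (Ψ i ∘ pre 1 (L i) 0 0 (M i) (a i)) '' (Bnew 1 (L i) 0 0 (M i) (a i)).lateRegion T₁) := by
    rw [iUnion_congr e8]
    exact hO
  have h9 : ∀ τ₁, T₁ < τ₁ → O \ (Φ₀ '' (Minkowski.backgroundOn U₁).lateRegion τ₁ ∪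
      ⋃ i, (Ψ i ∘ pre 1 (L i) 0 0 (M i) (a i)) '' {x : (Bnew 1 (L i) 0 0 (M i) (a i)).domain |
        τ₁ < (Bnew 1 (L i) 0 0 (M i) (a i)).time x.1 ∧
          (Bnew 1 (L i) 0 0 (M i) (a i)).radius x.1 ≤ R i ((Bnew 1 (L i) 0 0 (M i) (a i)).time x.1)}) ⊆
      𝒟.toSpacetime.metric.causalPast 𝒟.toSpacetime.timeOrientation
        (Φ₀ '' (Minkowski.backgroundOn U₁).timeSlab τ₁ ∪
          ⋃ i, (Ψ i ∘ pre 1 (L i) 0 0 (M i) (a i)) ''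
            (Bnew 1 (L i) 0 0 (M i) (a i)).truncTimeSlab (R i τ₁) τ₁) := by
    intro τ₁ hτ₁
    have e1 : ∀ i, (Ψ i ∘ pre 1 (L i) 0 0 (M i) (a i)) '' {x : (Bnew 1 (L i) 0 0 (M i) (a i)).domain |
        τ₁ < (Bnew 1 (L i) 0 0 (M i) (a i)).time x.1 ∧
          (Bnew 1 (L i) 0 0 (M i) (a i)).radius x.1 ≤ R i ((Bnew 1 (L i) 0 0 (M i) (a i)).time x.1)} =
        Ψ i '' {x : (boostedKerrBackground 1 0 (M i) (a i)).domain |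
          τ₁ < (boostedKerrBackground 1 0 (M i) (a i)).time x.1 ∧
            (boostedKerrBackground 1 0 (M i) (a i)).radius x.1 ≤
              R i ((boostedKerrBackground 1 0 (M i) (a i)).time x.1)} := fun i ↦
      image_comp_pre_setOf 1 (L i) 0 0 (M i) (a i) (Ψ i) fun t r ↦ τ₁ < t ∧ r ≤ R i t
    have e2 : ∀ i, (Ψ i ∘ pre 1 (L i) 0 0 (M i) (a i)) ''
        (Bnew 1 (L i) 0 0 (M i) (a i)).truncTimeSlab (R i τ₁) τ₁ =
          Ψ i '' (boostedKerrBackground 1 0 (M i) (a i)).truncTimeSlab (R i τ₁) τ₁ := fun i ↦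
      image_comp_pre_setOf 1 (L i) 0 0 (M i) (a i) (Ψ i) fun t r ↦ t = τ₁ ∧ r ≤ R i τ₁
    rw [iUnion_congr e1, iUnion_congr e2]
    exact hexh τ₁ hτ₁
  exact ⟨fun i ↦ ((L i)⁻¹ * 1, (L i : E4 ≃L[ℝ] E4).symm (0 - 0)),
    fun i ↦ Ψ i ∘ pre 1 (L i) 0 0 (M i) (a i),
    fun i t ↦ excR⟪(L i)⁻¹ * 1, (L i : E4 ≃L[ℝ] E4).symm (0 - 0), ρ, ξ i, t⟫,
    h1, h2, h3, h4, h5, h6, h7, h8, h9⟩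

end Transport

/-- **B₂a — BOOST TRANSPORT OF THE REST-FRAME SETTLED DATA** (crux `DispersingCapture`, line
`registered`, stub `stub_boostTransport`). Given rest-frame settled data on a vacuum Cauchy
development — flat chart `Φ₀` on `U₁ ⊇ {t > T₁} ∖ ⋃ᵢ{distᵢ ≤ ρ(t)}` with `ρ(t)/t → 0`, Kerr–Schild
hole charts `Ψᵢ` (late charts into `O` after `T₁`) converging in `C²` out to radii `Rᵢ(τ)`,
separation at every radius, region identity and exhaustion in the `certifiedLate`/`certifiedSlab`
shape, and (F) eventual future-directedness of `dΨᵢ(V_{Mᵢ,aᵢ})` on every truncated slab — and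
Cesàro velocities `t⁻¹ξᵢ(t) → vᵢ` with `‖vᵢ‖ ≤ V < 1`, the same data hold on the BOOSTED
exteriors of the pure boosts `boost vᵢ` (motions `(boost vᵢ, 0)` written as the relabelling
`((boost vᵢ)⁻¹⁻¹·1, (boost vᵢ)(0 − 0))` of the rest frame), with charts `Ψᵢ ∘ (boost vᵢ)⁻¹`, the
same late images, zones and slabs, truncated `C²` convergence multiplied by a finite constant,
sublinear straight excision tubes inside `U₁`, orthochronous motions and oriented hole slabs
(chain rule). Instance of `boostTransport_of_eq` at `B = fun i ↦ Kerr.background (Mᵢ) (aᵢ)`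
(`boostedKerrBackground_one_zero`). O'Neill 1983, Ch. 9; Kerr–Schild 1965; Dafermos–Luk
arXiv:1710.01722, Conjecture 1. -/
theorem stub_boostTransport : open scoped Manifold Topology in ∀ (X : Type) [TopologicalSpace X] [ChartedSpace (EuclideanSpace ℝ (Fin 3)) X] [IsManifold (𝓡 3) ((⊤ : ℕ∞) : WithTop ℕ∞) X] [T2Space X] [SecondCountableTopology X] [ConnectedSpace X], ∀ (D : Literature.Geometry.Lorentzian.InitialDataSet (𝓡 3) X) (𝒟 : Literature.Geometry.Lorentzian.VacuumCauchyDevelopment D) (N : ℕ) (M a : Fin N → ℝ) (T₁ V : ℝ) (ξ : Fin N → ℝ → EuclideanSpace ℝ (Fin 3)) (v : Fin N → EuclideanSpace ℝ (Fin 3)) (O : Set 𝒟.carrier) (U₁ : TopologicalSpace.Opens Literature.Geometry.Lorentzian.E4) (Φ₀ : (Literature.Geometry.Lorentzian.Minkowski.backgroundOn U₁).domain → 𝒟.carrier) (Ψ : (i : Fin N) → (Literature.Geometry.Lorentzian.Kerr.background (M i) (a i)).domain → 𝒟.carrier) (ρ : ℝ → ℝ) (R : Fin N → ℝ → ℝ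),
    V < 1 → (∀ i, ‖v i‖ ≤ V) → (∀ i, Filter.Tendsto (fun t : ℝ ↦ t⁻¹ • ξ i t) Filter.atTop (nhds (v i))) →
    (∀ i, 𝒟.toSpacetime.IsLateChart (Literature.Geometry.Lorentzian.Kerr.background (M i) (a i)) O T₁ (Ψ i)) →
    Filter.Tendsto (fun t ↦ ρ t / t) Filter.atTop (nhds 0) →
    {y : Literature.Geometry.Lorentzian.E4 | T₁ < y 0 ∧ ∀ i, ρ (y 0) < ‖Literature.Geometry.Lorentzian.E4.spatial y - ξ i (y 0)‖} ⊆ (U₁ : Set Literature.Geometry.Lorentzian.E4) →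
    (∀ i, Filter.Tendsto (R i) Filter.atTop Filter.atTop) →
    (∀ i, Filter.Tendsto (fun τ ↦ 𝒟.toSpacetime.truncDeviationCk (Literature.Geometry.Lorentzian.Kerr.background (M i) (a i)) (Ψ i) 2 (R i τ) τ) Filter.atTop (nhds 0)) →
    (∀ R' : ℝ, ∃ τ' : ℝ, Pairwise (Function.onFun Disjoint fun i ↦ Ψ i '' (Literature.Geometry.Lorentzian.Kerr.background (M i) (a i)).truncLateRegion τ' R')) →
    O = Summit.FinalStateConjecture.exteriorOf 𝒟.toCauchyDevelopment (Φ₀ '' (Literature.Geometry.Lorentzian.Minkowski.backgroundOn U₁).lateRegion T₁ ∪ ⋃ i, Ψ i '' (Literature.Geometry.Lorentzian.Kerr.background (M i) (a i)).lateRegion T₁) →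
    (∀ τ₁, T₁ < τ₁ → O \ (Φ₀ '' (Literature.Geometry.Lorentzian.Minkowski.backgroundOn U₁).lateRegion τ₁ ∪ ⋃ i, Ψ i '' {x : (Literature.Geometry.Lorentzian.Kerr.background (M i) (a i)).domain | τ₁ < (Literature.Geometry.Lorentzian.Kerr.background (M i) (a i)).time x.1 ∧ (Literature.Geometry.Lorentzian.Kerr.background (M i) (a i)).radius x.1 ≤ R i ((Literature.Geometry.Lorentzian.Kerr.background (M i) (a i)).time x.1)}) ⊆ 𝒟.toSpacetime.metric.causalPast 𝒟.toSpacetime.timeOrientation (Φ₀ '' (Literature.Geometry.Lorentzian.Minkowski.backgroundOn U₁).timeSlab τ₁ ∪ ⋃ i, Ψ i '' (Literature.Geometry.Lorentzian.Kerr.background (M i) (a i)).truncTimeSlab (R i τ₁) τ₁)) →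
    (∀ i (ρ' : ℝ), ∀ᶠ τ in Filter.atTop, ∀ x ∈ (Literature.Geometry.Lorentzian.Kerr.background (M i) (a i)).truncTimeSlab ρ' τ, 𝒟.toSpacetime.timeOrientation.IsFutureDirected (mfderiv 𝓘(ℝ, Literature.Geometry.Lorentzian.E4) (𝓡 4) (Ψ i) x (Literature.Geometry.Lorentzian.Kerr.timeVector (M i) (a i) x.1))) →
    ∃ (mo : Fin N → Literature.Geometry.Lorentzian.lorentzGroup × Literature.Geometry.Lorentzian.E4) (ψ : (i : Fin N) → (Literature.Geometry.Lorentzian.boostedKerrBackground (mo i).1 (mo i).2 (M i) (a i)).domain → 𝒟.carrier) (ρexc : Fin N → ℝ → ℝ),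
      (∀ i, 𝒟.toSpacetime.IsLateChart (Literature.Geometry.Lorentzian.boostedKerrBackground (mo i).1 (mo i).2 (M i) (a i)) O T₁ (ψ i)) ∧
      (∀ i, Filter.Tendsto (fun τ ↦ 𝒟.toSpacetime.truncDeviationCk (Literature.Geometry.Lorentzian.boostedKerrBackground (mo i).1 (mo i).2 (M i) (a i)) (ψ i) 2 (R i τ) τ) Filter.atTop (nhds 0)) ∧
      (∀ R' : ℝ, ∃ τ' : ℝ, Pairwise (Function.onFun Disjoint fun i ↦ ψ i '' (Literature.Geometry.Lorentzian.boostedKerrBackground (mo i).1 (mo i).2 (M i) (a i)).truncLateRegion τ' R')) ∧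
      (∀ i, Filter.Tendsto (fun t ↦ ρexc i t / t) Filter.atTop (nhds 0)) ∧
      {x : Literature.Geometry.Lorentzian.E4 | T₁ < x 0 ∧ ∀ i, ρexc i (x 0) < Literature.Geometry.Lorentzian.Kerr.radius (a i) (Literature.Geometry.Lorentzian.poincareInv (mo i).1 (mo i).2 x)} ⊆ (U₁ : Set Literature.Geometry.Lorentzian.E4) ∧
      (∀ i, Summit.FinalStateConjecture.IsOrthochronous (mo i).1) ∧
      (∀ i (ρ' : ℝ), ∀ᶠ τ in Filter.atTop, ∀ x ∈ (Literature.Geometry.Lorentzian.boostedKerrBackground (mo i).1 (mo i).2 (M i) (a i)).truncTimeSlab ρ' τ, 𝒟.toSpacetime.timeOrientation.IsFutureDirected (mfderiv 𝓘(ℝ, Literature.Geometry.Lorentzian.E4) (𝓡 4) (ψ i) x (((mo i).1 : Literature.Geometry.Lorentzian.E4 ≃L[ℝ] Literature.Geometry.Lorentzian.E4) (Literature.Geometry.Lorentzian.Kerr.timeVector (M i) (a i) (Literature.Geometry.Lorentzian.poincareInv (mo i).1 (mo i).2 (x : Literature.Geometry.Lorentzian.E4)))))) ∧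
      O = Summit.FinalStateConjecture.exteriorOf 𝒟.toCauchyDevelopment (Φ₀ '' (Literature.Geometry.Lorentzian.Minkowski.backgroundOn U₁).lateRegion T₁ ∪ ⋃ i, ψ i '' (Literature.Geometry.Lorentzian.boostedKerrBackground (mo i).1 (mo i).2 (M i) (a i)).lateRegion T₁) ∧
      (∀ τ₁, T₁ < τ₁ → O \ (Φ₀ '' (Literature.Geometry.Lorentzian.Minkowski.backgroundOn U₁).lateRegion τ₁ ∪ ⋃ i, ψ i '' {x : (Literature.Geometry.Lorentzian.boostedKerrBackground (mo i).1 (mo i).2 (M i) (a i)).domain | τ₁ < (Literature.Geometry.Lorentzian.boostedKerrBackground (mo i).1 (mo i).2 (M i) (a i)).time x.1 ∧ (Literature.Geometry.Lorentzian.boostedKerrBackground (mo i).1 (mo i).2 (M i) (a i)).radius x.1 ≤ R i ((Literature.Geometry.Lorentzian.boostedKerrBackground (mo i).1 (mo i).2 (M i) (a i)).time x.1)}) ⊆ 𝒟.toSpacetime.metric.causalPast 𝒟.toSpacetime.timeOrientation (Φ₀ '' (Literature.Geometry.Lorentzian.Minkowski.backgroundOn U₁).timeSlab τ₁ ∪ ⋃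 i, ψ i '' (Literature.Geometry.Lorentzian.boostedKerrBackground (mo i).1 (mo i).2 (M i) (a i)).truncTimeSlab (R i τ₁) τ₁)) := by
  intro X _ _ _ _ _ _ D 𝒟 N M a T₁ V ξ v O U₁ Φ₀ Ψ ρ R hV hv hces hΨ hρ hU₁ _ hconv hsep hO hexh hF
  exact boostTransport_of_eq 𝒟 N M a T₁ V ξ v O U₁ Φ₀ (fun i ↦ Kerr.background (M i) (a i))
    (funext fun i ↦ (boostedKerrBackground_one_zero (M i) (a i)).symm) Ψ ρ R hV hv hces hΨ hρ hU₁
    hconv hsep hO hexh hF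

end Summit.FinalStateConjecture.FinalStateConjecture.Theorems.DissipativeFinalMotions.DispersingCapture

end
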